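import Mathlib
import Summits.Schanuel.Schanuel.Theses.RigidCore
import Summits.Schanuel.Schanuel.Theorems.RigidCoreMinimalCounterexampleInAclNoFullLine

/-!
# Isolation analysis of the hit pattern: mates in a rational box
# (crux stmt-Schanuel-0969 `RigidCore.MinimalCounterexampleInAcl`, line kernel-arithmetic-selection, stub S8‴)

`--supports stmt-Schanuel-0969`; the analytic/algebraic half of the registered stub `stub_corankOne_hitSetRingDefinable` (S8‴: the
hit pattern `H_x = {κ ∈ ℤ^m : (x_k + 2πiκ_k)_{k<m} is the u-part of a mate of x}` of a corank-one first failure `x` is ring-definable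
over `ℤ`).  Write `u'_κ = (x_k + 2πiκ_k)_k` and `x'(κ, z) = (u'_κ, z) ∈ ℂ^{m+1}` (`Fin.snoc`).  This file proves the
PRESENTATION OF `H_x` BY AN ISOLATING BOX (`mem_hitSet_iff_box`, registered helper): for any functions `F`, `G_N : ℂ → ℝ` whose
zero sets are `{z : x'(κ,z) ∈ locusPts x}` and `{z : x'(κ,z) ∈ locusPts x ∧ Σ Nᵢ x'(κ,z)ᵢ = 0}`,

  `κ ∈ H_x ↔ ∃ closed rational box B ⊆ ℂ, (∃ z ∈ B, F z = 0) ∧ ∀ N ∈ ℤ^{m+1} ∖ 0, ¬ ∃ z ∈ B, G_N z = 0`,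

i.e. "some box contains a point of the pulled-back locus and every such point in it is ℚ-linearly independent".  Ingredients:

* `exists_finset_generators_locusPts` — HILBERT BASIS: membership in `locusPts x` is the vanishing of finitely many ℚ-polynomial
  relations of `(x, eˣ)` (so `F` can be a finite sum of squared norms — done in the assembling file);
* `linearIndependent_iff_forall_int` — ℚ-linear independence = no non-trivial INTEGER relation;
* `finite_slice_locusPts_of_mate` — if `x'(κ, z₀)` is a mate then `{z : x'(κ, z) ∈ locusPts x}` is FINITE: `x` satisfies a
  non-zero ℚ-polynomial `P` (transcendence degree `< m + 1`), `u'_κ` is algebraically independent (the mate is a first failure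
  in corank-one normal form, `algebraicIndependent_castSucc`), so `z ↦ P(u'_κ, z)` is a non-zero polynomial over the domain
  `ℚ[u'_κ]` (`AlgebraicIndependent.mvPolynomialOptionEquivPolynomialAdjoin`) and has finitely many roots.  Finiteness gives
  the isolating box; the converse direction is bookkeeping.

No computability or definability here; the conversion of "∃ zero in a box" into a first-order statement over `ℤ` is
`…HitSetExpEnclosure.lean`, the assembly is `…HitSetRingDefinable.lean`.
-/

noncomputable section

-- the summit namespace `Summit.Schanuel.Schanuel.…` repeats a component by design (D-0022)
set_option linter.dupNamespace false

open Complex Set MvPolynomial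

namespace Summit.Schanuel.Schanuel.Cruxes.MinimalCounterexampleInAcl.KernelArithmeticSelection

open Literature.NumberTheory.Transcendental

variable {n m : ℕ}

/-! ## Hilbert basis: finitely many relations cut out the pulled-back locus -/

/-- **Finitely many ℚ-polynomial relations of `(x, eˣ)` define `locusPts x`** (the relation ideal of `(x, eˣ)` in the
Noetherian ring `ℚ[X, Y]` is finitely generated). [folklore] -/
theorem exists_finset_generators_locusPts (x : Fin n → ℂ) :
    ∃ S : Finset (MvPolynomial (Fin n ⊕ Fin n) ℚ),
      (∀ p ∈ S, MvPolynomial.aeval (Sum.elim x (cexp ∘ x)) p = 0) ∧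
      ∀ x' : Fin n → ℂ, (∀ p ∈ S, MvPolynomial.aeval (Sum.elim x' (cexp ∘ x')) p = 0) → x' ∈ locusPts x := by
  set I : Ideal (MvPolynomial (Fin n ⊕ Fin n) ℚ) :=
    RingHom.ker (MvPolynomial.aeval (Sum.elim x (cexp ∘ x)) : MvPolynomial (Fin n ⊕ Fin n) ℚ →ₐ[ℚ] ℂ) with hI
  haveI : IsNoetherianRing (MvPolynomial (Fin n ⊕ Fin n) ℚ) := MvPolynomial.isNoetherianRing
  obtain ⟨S, hS⟩ := IsNoetherian.noetherian I
  refine ⟨S, fun p hp => ?_, fun x' hx' p hp0 => ?_⟩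
  · have : p ∈ I := by rw [← hS]; exact Ideal.subset_span hp
    simpa [hI] using this
  · have hpI : p ∈ I := by simpa [hI] using hp0
    have hle : I ≤ RingHom.ker (MvPolynomial.aeval (Sum.elim x' (cexp ∘ x')) : MvPolynomial (Fin n ⊕ Fin n) ℚ →ₐ[ℚ] ℂ) := by
      rw [← hS]
      exact Ideal.span_le.2 fun q hq => by simpa using hx' q hq
    simpa using hle hpI

/-! ## ℚ-linear independence through integer relations -/

/-- A finite family of complex numbers is ℚ-linearly independent iff it has no non-trivial integer relation. [folklore] -/
theorem linearIndependent_iff_forall_int {ι : Type*} [Fintype ι] (v : ι → ℂ) :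
    LinearIndependent ℚ v ↔ ∀ N : ι → ℤ, (∑ i, (N i : ℂ) * v i) = 0 → N = 0 := by
  rw [← LinearIndependent.iff_fractionRing ℤ ℚ, Fintype.linearIndependent_iff]
  simp only [zsmul_eq_mul, funext_iff, Pi.zero_apply]

/-! ## Finiteness of the slice of the pulled-back locus over the u-part of a mate -/

/-- A first failure satisfies a non-zero ℚ-polynomial relation among its coordinates (its transcendence degree is `< m + 1`).
[folklore] -/
theorem exists_mvPolynomial_ne_zero_aeval_eq_zero {x : Fin (m + 1) → ℂ} (hx : x ∈ firstFailures (m + 1)) :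
    ∃ P : MvPolynomial (Fin (m + 1)) ℚ, P ≠ 0 ∧ MvPolynomial.aeval x P = 0 := by
  by_contra hne
  push Not at hne
  have hind : AlgebraicIndependent ℚ x :=
    (injective_iff_map_eq_zero _).2 fun P hP => by_contra fun h => hne P h hP
  set L : IntermediateField ℚ ℂ := IntermediateField.adjoin ℚ (range x ∪ range (cexp ∘ x)) with hL
  have hmem : ∀ i, x i ∈ L := fun i => IntermediateField.subset_adjoin ℚ _ (Or.inl ⟨i, rfl⟩)
  let v : Fin (m + 1) → L := fun i => ⟨x i, hmem i⟩
  have hv : AlgebraicIndependent ℚ v := AlgebraicIndependent.of_comp L.val hind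
  have hle := hv.cardinalMk_le_trdeg
  simp only [Cardinal.mk_fintype, Fintype.card_fin] at hle
  exact (not_le.2 hx.2.1) (by exact_mod_cast hle)

/-- Over an algebraically independent `u' ∈ ℂ^m`, a non-zero `P ∈ ℚ[X₀, …, X_m]` has finitely many zeros `z` of
`P(u', z) = 0` (`P(u', ·)` is a non-zero polynomial over the domain `ℚ[u']`). [folklore] -/
theorem finite_setOf_aeval_snoc_eq_zero {u' : Fin m → ℂ} (hu : AlgebraicIndependent ℚ u')
    {P : MvPolynomial (Fin (m + 1)) ℚ} (hP : P ≠ 0) :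
    Set.Finite {z : ℂ | MvPolynomial.aeval (Fin.snoc u' z : Fin (m + 1) → ℂ) P = 0} := by
  -- move the last variable to `none : Option (Fin m)`
  set Q : MvPolynomial (Option (Fin m)) ℚ := MvPolynomial.rename finSuccEquivLast P with hQ
  have hQ0 : Q ≠ 0 := fun h => hP (MvPolynomial.rename_injective _ finSuccEquivLast.injective (by simpa [hQ] using h))
  have hsnoc : ∀ z : ℂ, (Fin.snoc u' z : Fin (m + 1) → ℂ) = (fun o : Option (Fin m) => o.elim z u') ∘ finSuccEquivLast := by
    intro z; funext i
    refine Fin.lastCases ?_ (fun k => ?_) i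
    · simp [finSuccEquivLast_last]
    · simp [finSuccEquivLast_castSucc]
  -- the univariate polynomial over `ℚ[u']`
  set G := hu.mvPolynomialOptionEquivPolynomialAdjoin Q with hG
  have hG0 : G ≠ 0 := by
    rw [hG]; exact (map_ne_zero_iff _ hu.mvPolynomialOptionEquivPolynomialAdjoin.injective).2 hQ0
  set Gc : Polynomial ℂ := Polynomial.map (algebraMap (Algebra.adjoin ℚ (range u')) ℂ) G with hGc
  have hGc0 : Gc ≠ 0 := by
    rw [hGc]
    exact (Polynomial.map_ne_zero_iff (FaithfulSMul.algebraMap_injective _ _)).2 hG0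
  have heval : ∀ z : ℂ, MvPolynomial.aeval (Fin.snoc u' z : Fin (m + 1) → ℂ) P = Polynomial.eval z Gc := by
    intro z
    rw [hsnoc, ← MvPolynomial.aeval_rename, ← hQ, hGc, Polynomial.eval_map, ← Polynomial.aeval_def]
    have h := hu.aeval_comp_mvPolynomialOptionEquivPolynomialAdjoin z
    have h' := congrArg (fun φ : MvPolynomial (Option (Fin m)) ℚ →+* ℂ => φ Q) h
    simpa [hG] using h'.symm
  refine (Polynomial.finite_setOf_isRoot hGc0).subset fun z hz => ?_
  simp only [mem_setOf_eq] at hz ⊢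
  rw [Polynomial.IsRoot.def, ← heval]; exact hz

/-- **Finiteness of the slice.**  If `x'(κ, z₀) = (u'_κ, z₀)` is a mate of the corank-one first failure `x`, then only finitely
many `z` put `x'(κ, z)` in the pulled-back locus of `(x, eˣ)`. [folklore] -/
theorem finite_slice_locusPts_of_mate {x : Fin (m + 1) → ℂ} (hx : x ∈ firstFailures (m + 1))
    (halg : ∀ i : Fin (m + 1), (i : ℕ) < m → IsAlgebraic ℚ (cexp (x i))) (κ : Fin m → ℤ) {z₀ : ℂ}
    (hz₀ : (Fin.snoc (fun k => x (Fin.castSucc k) + 2 * ↑Real.pi * I * (κ k : ℂ)) z₀ : Fin (m + 1) → ℂ) ∈ locusMates x) :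
    Set.Finite {z : ℂ | (Fin.snoc (fun k => x (Fin.castSucc k) + 2 * ↑Real.pi * I * (κ k : ℂ)) z : Fin (m + 1) → ℂ) ∈
      locusPts x} := by
  set u' : Fin m → ℂ := fun k => x (Fin.castSucc k) + 2 * ↑Real.pi * I * (κ k : ℂ) with hu'
  -- the mate is a first failure in corank-one normal form, so `u'` is algebraically independent
  have hff := (mate_firstFailure_voc hx hz₀).1
  have halg' : ∀ i : Fin (m + 1), (i : ℕ) < m → IsAlgebraic ℚ (cexp ((Fin.snoc u' z₀ : Fin (m + 1) → ℂ) i)) := by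
    intro i hi
    have hne : i ≠ Fin.last m := fun h => by rw [h] at hi; simp at hi
    obtain ⟨k, rfl⟩ := Fin.eq_castSucc_of_ne_last hne
    rw [Fin.snoc_castSucc, hu']
    simp only
    rw [Complex.exp_add, mul_comm (2 * ↑Real.pi * I) ((κ k : ℂ)), Complex.exp_int_mul_two_pi_mul_I, mul_one]
    exact halg (Fin.castSucc k) (by simp)
  have hind : AlgebraicIndependent ℚ u' := by
    have := algebraicIndependent_castSucc hff halg'
    simpa only [Fin.snoc_castSucc] using this
  obtain ⟨P, hP0, hPx⟩ := exists_mvPolynomial_ne_zero_aeval_eq_zero hx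
  refine (finite_setOf_aeval_snoc_eq_zero hind hP0).subset fun z hz => ?_
  simp only [mem_setOf_eq] at hz ⊢
  have h := hz (MvPolynomial.rename Sum.inl P) (by rw [MvPolynomial.aeval_rename]; simpa using hPx)
  rw [MvPolynomial.aeval_rename] at h
  simpa using h

/-! ## The hit pattern through an isolating box -/

/-- The hit pattern in `Fin.snoc` form: `u'_κ` is the u-part of a mate iff `(u'_κ, z)` is a mate for some `z`. -/
theorem mem_hitSet_iff_exists_snoc (x : Fin (m + 1) → ℂ) (κ : Fin m → ℤ) :
    (fun k => x (Fin.castSucc k) + 2 * ↑Real.pi * I * (κ k : ℂ)) ∈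
        {v : Fin m → ℂ | ∃ x' ∈ locusMates x, ∀ k, v k = x' (Fin.castSucc k)} ↔
      ∃ z : ℂ, (Fin.snoc (fun k => x (Fin.castSucc k) + 2 * ↑Real.pi * I * (κ k : ℂ)) z : Fin (m + 1) → ℂ) ∈
        locusMates x := by
  constructor
  · rintro ⟨x', hx', hv⟩
    refine ⟨x' (Fin.last m), ?_⟩
    convert hx' using 1
    funext i
    refine Fin.lastCases ?_ (fun k => ?_) i
    · simp
    · rw [Fin.snoc_castSucc]; exact hv k
  · rintro ⟨z, hz⟩
    exact ⟨_, hz, fun k => by rw [Fin.snoc_castSucc]⟩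

/-- A closed rational box of mesh `1/d` around a point: integers `a₁ < re·d ≤ a₁ + 1`, so that the point lies in
`[a₁/d, (a₁+1)/d]` and every point of that interval is within `1/d`. -/
theorem exists_int_interval (t : ℝ) {d : ℤ} (hd : 0 < d) :
    ∃ a : ℤ, (a : ℝ) / d ≤ t ∧ t ≤ ((a + 1 : ℤ) : ℝ) / d ∧
      ∀ s : ℝ, (a : ℝ) / d ≤ s → s ≤ ((a + 1 : ℤ) : ℝ) / d → |s - t| ≤ 1 / d := by
  have hd' : (0 : ℝ) < d := by exact_mod_cast hd
  have h1 : ((⌈t * d⌉ - 1 : ℤ) : ℝ) / d ≤ t := by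
    rw [div_le_iff₀ hd']; push_cast; linarith [Int.ceil_lt_add_one (t * d)]
  have h2 : t ≤ ((⌈t * d⌉ - 1 + 1 : ℤ) : ℝ) / d := by
    rw [le_div_iff₀ hd']; push_cast; linarith [Int.le_ceil (t * d)]
  have e : ((⌈t * d⌉ - 1 + 1 : ℤ) : ℝ) / d = ((⌈t * d⌉ - 1 : ℤ) : ℝ) / d + 1 / d := by
    push_cast; ring
  refine ⟨⌈t * d⌉ - 1, h1, h2, fun s hs1 hs2 => ?_⟩
  rw [abs_sub_le_iff]
  constructor <;> linarith

/-- Registered helper stub `mem_hitSet_iff_box` of crux stmt-Schanuel-0969 (line kernel-arithmetic-selection, S8‴):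
**the hit pattern through an isolating rational box.**  For a corank-one first failure `x` of rank `m + 1`, `κ ∈ ℤ^m`, and any
real functions `F`, `G_N` on `ℂ` vanishing exactly where `x'(κ, z) = (x_k + 2πiκ_k, z)_k` lies in the pulled-back locus of
`(x, eˣ)`, resp. lies there AND satisfies the integer relation `N`: `κ` is in the hit pattern iff some closed rational box contains
a zero of `F` and, for every `N ≠ 0`, no zero of `G_N` (finiteness of the slice gives the isolating box). [folklore] -/
theorem mem_hitSet_iff_box : ∀ (m : ℕ) (x : Fin (m + 1) → ℂ), x ∈ Summit.Schanuel.Schanuel.Cruxes.MinimalCounterexampleInAcl.KernelArithmeticSelection.firstFailures (m + 1) → (∀ i : Fin (m + 1), (i : ℕ) < m → IsAlgebraic ℚ (Complex.exp (x i))) → ∀ (κ : Fin m → ℤ) (F : ℂ → ℝ) (G : (Fin (m + 1) → ℤ) → ℂ → ℝ), (∀ z : ℂ, F z = 0 ↔ (Fin.snoc (fun k => x (Fin.castSucc k) + 2 * ↑Real.pi * Complex.I * (κ k : ℂ)) z : Fin (m + 1) → ℂ) ∈ Summit.Schanuel.Schanuel.Cruxes.MinimalCounterexampleInAcl.KernelArithmeticSelection.locusPts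 x) → (∀ (N : Fin (m + 1) → ℤ) (z : ℂ), G N z = 0 ↔ ((Fin.snoc (fun k => x (Fin.castSucc k) + 2 * ↑Real.pi * Complex.I * (κ k : ℂ)) z : Fin (m + 1) → ℂ) ∈ Summit.Schanuel.Schanuel.Cruxes.MinimalCounterexampleInAcl.KernelArithmeticSelection.locusPts x ∧ ∑ i, (N i : ℂ) * (Fin.snoc (fun k => x (Fin.castSucc k) + 2 * ↑Real.pi * Complex.I * (κ k : ℂ)) z : Fin (m + 1) → ℂ) i = 0)) → ((fun k => x (Fin.castSucc k) + 2 * ↑Real.pi * Complex.I * (κ k : ℂ)) ∈ {v : Fin m → ℂ | ∃ x' ∈ Summit.Schanuel.Schanuel.Cruxes.MinimalCounterexampleInAcl.KernelArithmeticSelection.locusMates x, ∀ k, v k = x' (Fin.castSucc k)} ↔ ∃ b : Fin 5 → ℤ, 0 < b 4 ∧ (∃ z : ℂ, ((b 0 : ℝ) / (b 4 : ℝ) ≤ z.re ∧ z.re ≤ (b 1 : ℝ) / (b 4 : ℝ) ∧ (b 2 : ℝ) / (b 4 : ℝ) ≤ z.im ∧ z.im ≤ (b 3 : ℝ) / (b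 4 : ℝ)) ∧ F z = 0) ∧ ∀ N : Fin (m + 1) → ℤ, N ≠ 0 → ¬ ∃ z : ℂ, ((b 0 : ℝ) / (b 4 : ℝ) ≤ z.re ∧ z.re ≤ (b 1 : ℝ) / (b 4 : ℝ) ∧ (b 2 : ℝ) / (b 4 : ℝ) ≤ z.im ∧ z.im ≤ (b 3 : ℝ) / (b 4 : ℝ)) ∧ G N z = 0) := by
  intro m x hx halg κ F G hF hG
  set u' : Fin m → ℂ := fun k => x (Fin.castSucc k) + 2 * ↑Real.pi * I * (κ k : ℂ) with hu'
  rw [mem_hitSet_iff_exists_snoc]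
  constructor
  · -- an isolating box around the last coordinate of a mate
    rintro ⟨z₀, hz₀⟩
    have hfin := finite_slice_locusPts_of_mate hx halg κ hz₀
    set Z : Set ℂ := {z : ℂ | (Fin.snoc u' z : Fin (m + 1) → ℂ) ∈ locusPts x} with hZ
    have hopen : IsOpen (Z \ {z₀})ᶜ := (hfin.subset fun z hz => hz.1).isClosed.isOpen_compl
    have hz₀mem : z₀ ∈ (Z \ {z₀})ᶜ := fun h => h.2 rfl
    obtain ⟨ε, hε, hball⟩ := Metric.isOpen_iff.1 hopen z₀ hz₀mem
    obtain ⟨d, hd⟩ := exists_nat_gt (2 / ε)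
    have hd0 : (0 : ℤ) < (d : ℤ) + 1 := by positivity
    have hdε : 2 / (((d : ℤ) + 1 : ℤ) : ℝ) < ε := by
      rw [div_lt_iff₀ (by positivity)]; push_cast
      rw [div_lt_iff₀ hε] at hd; nlinarith
    obtain ⟨a, ha1, ha2, ha⟩ := exists_int_interval z₀.re hd0
    obtain ⟨c, hc1, hc2, hc⟩ := exists_int_interval z₀.im hd0
    -- points of the box are within `ε` of `z₀`
    have hnear : ∀ z : ℂ, (a : ℝ) / (((d : ℤ) + 1 : ℤ) : ℝ) ≤ z.re → z.re ≤ ((a + 1 : ℤ) : ℝ) / (((d : ℤ) + 1 : ℤ) : ℝ) →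
        (c : ℝ) / (((d : ℤ) + 1 : ℤ) : ℝ) ≤ z.im → z.im ≤ ((c + 1 : ℤ) : ℝ) / (((d : ℤ) + 1 : ℤ) : ℝ) → dist z z₀ < ε := by
      intro z h1 h2 h3 h4
      have hre := ha z.re h1 h2
      have him := hc z.im h3 h4
      rw [dist_eq_norm]
      calc ‖z - z₀‖ ≤ |(z - z₀).re| + |(z - z₀).im| := Complex.norm_le_abs_re_add_abs_im _
        _ ≤ 1 / (((d : ℤ) + 1 : ℤ) : ℝ) + 1 / (((d : ℤ) + 1 : ℤ) : ℝ) := by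
          rw [Complex.sub_re, Complex.sub_im]; exact add_le_add hre him
        _ = 2 / (((d : ℤ) + 1 : ℤ) : ℝ) := by ring
        _ < ε := hdε
    have huniq : ∀ z : ℂ, z ∈ Z → dist z z₀ < ε → z = z₀ := by
      intro z hzZ hdist
      by_contra hne
      exact hball (Metric.mem_ball.2 hdist) ⟨hzZ, hne⟩
    refine ⟨![a, a + 1, c, c + 1, (d : ℤ) + 1], hd0, ⟨z₀, ?_, (hF z₀).2 hz₀.2⟩, fun N hN => ?_⟩
    · simp only [Matrix.cons_val_zero, Matrix.cons_val_one, Matrix.cons_val]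
      exact ⟨ha1, ha2, hc1, hc2⟩
    · rintro ⟨z, hzb, hGz⟩
      simp only [Matrix.cons_val_zero, Matrix.cons_val_one, Matrix.cons_val] at hzb
      obtain ⟨hzZ, hsum⟩ := (hG N z).1 hGz
      have hzz : z = z₀ := huniq z hzZ (hnear z hzb.1 hzb.2.1 hzb.2.2.1 hzb.2.2.2)
      subst hzz
      exact hN ((linearIndependent_iff_forall_int _).1 hz₀.1 N hsum)
  · -- a point of the locus in the box all of whose integer relations are excluded is a mate
    rintro ⟨b, hb, ⟨z, hzb, hFz⟩, hall⟩
    have hzZ := (hF z).1 hFz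
    refine ⟨z, ?_, hzZ⟩
    rw [mem_setOf_eq, linearIndependent_iff_forall_int]
    intro N hsum
    by_contra hN
    exact hall N hN ⟨z, hzb, (hG N z).2 ⟨hzZ, hsum⟩⟩

end Summit.Schanuel.Schanuel.Cruxes.MinimalCounterexampleInAcl.KernelArithmeticSelection
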